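import Summits.QuantumFields.YangMills.Theses.CertificationLength
import Summits.QuantumFields.YangMills.Theorems.ConvexGribovBodyNonSimplyConnectedLatticeGapStubBoxInfluenceDecayAtOfCellFiniteSize
import Summits.QuantumFields.YangMills.Theorems.ConvexGribovBodyNonSimplyConnectedLatticeGapStubGaugeInvariantUniqueness
import Summits.QuantumFields.YangMills.Theorems.ConvexGribovBodyNonSimplyConnectedLatticeGapStubDlrGaugeInvariant
import Summits.QuantumFields.YangMills.Theorems.ConvexGribovBodyNonSimplyConnectedLatticeGapStubDlrEqOfGaugeInvariantAgreement
import Summits.QuantumFields.YangMills.Theorems.ConvexGribovBodyNonSimplyConnectedLatticeGapStubUniqueInfiniteVolumeLimitOfDlrUnique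
import HarnessLib

/-!
# `UniqueStateFromCertificate` (item stmt-QuantumFields-16183, route `CertificationLength`): proof

The Dobrushin–Shlosman total-variation finite-size condition for the Wilson specification
`ymSpecification r.ρ β` at one coupling `β` (window `n`, threshold `ε` with `ε M(n) < 1`, cell size `b`)
implies that the torus Wilson states at `β` converge and have exactly one infinite-volume limit point
(tree `HasUniqueInfiniteVolumeLimit r.ρ β`).

Proof = composition of four side-stubs of line `Sketch` (v6/v7) of crux stmt-QuantumFields-16405, all landed
in namespace `Summit.QuantumFields.YangMills.Theorems.NonSimplyConnectedLatticeGap`: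

1. `stub_boxInfluenceDecayAt_of_cellFiniteSize` (p130046): the finite-size condition gives exponential decay
   (rate `m > 0`) of the influence of exterior data on the cube kernels `γ_{Λ_L}` for every gauge-invariant
   local observable (Dobrushin–Shlosman block recursion, tree `FiniteSizeCriterion.box_influence_le`);
2. `stub_gaugeInvariantUniqueness_of_boxInfluenceDecay` (p129742): hence any two DLR states agree on
   gauge-invariant local observables (DLR equation + `L → ∞`);
3. `stub_dlr_gaugeInvariant` (p130130, Elitzur in DLR form) and `stub_dlr_eq_of_gaugeInvariantAgreement`
   (p130823, gauge averaging): hence any two DLR states coincide, `|𝒢(β)| ≤ 1`;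
4. `stub_uniqueInfiniteVolumeLimit_of_dlrUnique` (p130112): limit points exist and are DLR, so the full
   torus sequence converges to the unique DLR state, which is the only limit point.

Hausdorffness and second countability of `G` come from the faithful continuous representation `r`.

References: R. L. Dobrushin, S. B. Shlosman (1985), §2; H.-O. Georgii, *Gibbs Measures and Phase
Transitions* (2011), Thm. 4.17, §8.2; S. Friedli, Y. Velenik (2017), Thm. 6.26, Lemma 6.30.
-/

set_option autoImplicit false

noncomputable section

open MeasureTheory
open Literature.MathematicalPhysics.QuantumLattice
open Literature.MathematicalPhysics.QuantumFieldTheory (LatticeRep)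

namespace Summit.QuantumFields.YangMills.Theorems

open NonSimplyConnectedLatticeGap in
/-- **`UniqueStateFromCertificate` holds** (item stmt-QuantumFields-16183 of route `CertificationLength`): the
Dobrushin–Shlosman TV finite-size condition at `(β, b)` for `ymSpecification r.ρ β` implies
`HasUniqueInfiniteVolumeLimit r.ρ β`. Composition of the landed lemmas listed in the module docstring. -/
theorem uniqueStateFromCertificate_proof :
    Summit.QuantumFields.YangMills.Theses.CertificationLength.UniqueStateFromCertificate := by
  intro G _ _ _ _
  letI : MeasurableSpace G := borel G
  haveI : BorelSpace G := ⟨rfl⟩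
  show ∀ (r : LatticeRep G) (n : ℕ) (ε : ℝ), 1 ≤ n → 0 ≤ ε →
    ε * ((((4 * n + 3) ^ 4 - (4 * n + 1) ^ 4 : ℕ)) : ℝ) < 1 → ∀ (β : ℝ) (b : ℕ), 1 ≤ b → _ →
    HasUniqueInfiniteVolumeLimit (d := 4) r.ρ β
  intro r n ε hn hε hq β b hb hFS
  haveI : T2Space G := (r.continuous.isClosedEmbedding r.injective).isEmbedding.t2Space
  haveI : SecondCountableTopology G :=
    (r.continuous.isClosedEmbedding r.injective).isEmbedding.secondCountableTopology
  obtain ⟨m, hm, hdec⟩ :=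
    stub_boxInfluenceDecayAt_of_cellFiniteSize G r.N r.ρ r.continuous β n ε b hn hε hq hb hFS
  have huniq : ∀ μ ν : Measure (LGConfig 4 G), μ ∈ ymGibbsMeasures r.ρ β →
      ν ∈ ymGibbsMeasures r.ρ β → μ = ν := fun μ ν hμ hν =>
    stub_dlr_eq_of_gaugeInvariantAgreement G r.N r.ρ r.continuous β μ ν hμ hν
      (stub_dlr_gaugeInvariant G r.N r.ρ r.continuous β μ hμ)
      (stub_dlr_gaugeInvariant G r.N r.ρ r.continuous β ν hν)
      (stub_gaugeInvariantUniqueness_of_boxInfluenceDecay G r.N r.ρ r.continuous β m hm hdec μ ν hμ hν)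
  exact stub_uniqueInfiniteVolumeLimit_of_dlrUnique G r.N r.ρ r.continuous β huniq

end Summit.QuantumFields.YangMills.Theorems

end
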